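import Literature.AlgebraicGeometry.Frobenioids.ArchimedeanTwistLift
import Literature.AlgebraicGeometry.Frobenioids.ArchimedeanIsometrization
import Literature.AlgebraicGeometry.Frobenioids.ArchimedeanPseudoTerminal
import HarnessLib

/-!
# Frobenioids II, Theorem 3.6 (i)/(ii), the typology clauses — PROVED for `C = C^ℤ` and `A`:
# `Aut`-ample, `Aut^sub`-ample, `End`-ample, metrically trivial, (not) group-like

Mochizuki, *The geometry of Frobenioids II*, Kyushu J. Math. **62** (2008) 401–460, §3, Theorem 3.6,
author's kurims text [cite: MochizukiFrdII2008, Thm 3.6 (i) p.36]: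

> (i) "… moreover, the Frobenioid `C^Λ` is of `Aut`-ample, `Aut^sub`-ample, `End`-ample, and metrically
> trivial type, but not of group-like type." (p. 36)
> (ii) "The Frobenioid `A` is of `Aut`-ample, `Aut^sub`-ample, `End`-ample, group-like, and metrically
> trivial type." (p. 37)

Proof (p. 38): "By [the earlier portion of] Lemma 3.2, (ii), it is immediate from the construction of `C^Λ`
that `C^Λ` is of `Aut`-ample, `Aut^sub`-ample, and `End`-ample type. Also, it is immediate from the
construction of `C^Λ` that `C^Λ` is of metrically trivial […] type, but not of group-like type".

DISCHARGES, over ANY base `π : D → D₀`: the instance `ArchFrd.Thm36ii_ampleTypes_A π` of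
`ArchimedeanTheoremsInstances.lean` UNCONDITIONALLY (`thm36ii_ampleTypes_A`), and the generic predicate
`ArchFrd.Thm36i_ampleTypes` of `ArchimedeanBasicProperties.lean` at `F := C.toElem π` — the `Λ = ℤ`
conjunct of the instance `Thm36i_ampleTypes_C π pf rlf` — under the standing hypothesis of Example 3.3 (i)
that `D` is connected (found's `IsGraphConnected D`, needed only for "not of group-like type", which asks
for an object); the conjuncts `Λ ∈ {ℚ, ℝ}` of that instance speak about the INTERFACE `LambdaCompletion`
(abc-iut-L1-t6; `C^pf`, `C^rlf` not yet constructed) and are not treated here.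

How ([FrdI] Def. 1.2 (iv) as typed by found, `PreFrobenioidMorphisms.lean`): `Aut`/`End`-ample by the
endomorphisms `liftEnd` of `ArchimedeanTwistLift.lean` (Lemma 3.2 (ii)); `Aut^sub`-ample by transporting
them along the twisted object `X|_b → X`; metrically trivial for `C` from the factorization of Thm. 3.6
(iii) (`thm36iii_factorization_C`: a co-angular pre-step `ψ = β ∘ α` with `α` an isometric pre-step forces
`α`, hence `ψ`'s codomain, to be isomorphic to the domain) and for `A` directly from the definition of
"co-angular" (every arrow of `A` is an isometric for `A`'s structure); "group-like" for `A` is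
abc-iut-L1-t6's `A.isOfType_isGroupLikeObj`; "not group-like" for `C`: `Φ(A) = ℝ_{≥0} ≠ 0` at the
pseudo-terminal object `unitObjOver` over any object of `D`. No statement of the paper is strengthened.
-/

namespace Literature.AlgebraicGeometry.Frobenioids

open CategoryTheory
open scoped NNReal

noncomputable section

universe v u

namespace ArchFrd

variable {D : Type u} [Category.{v} D] (π : D ⥤ D0)

/-! ### Endomorphisms and automorphisms of an object of `C` over those of its base -/

/-- The endomorphism of `Spec K = Base(X)` in `D₀` under an endomorphism `f` of `A_D` for
`A = (X, A_D, X_base ≅ π(A_D)) ∈ Ob(C)`. [cite: MochizukiFrdII2008, Ex 3.3 (i) p.28] -/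
def baseTwist (A : C π) (f : A.snd ⟶ A.snd) : A.fst.base ⟶ A.fst.base := A.iso.hom ≫ π.map f ≫ A.iso.inv

/-- `baseTwist` is multiplicative. [cite: MochizukiFrdII2008, Ex 3.3 (i) p.28] -/
theorem baseTwist_comp (A : C π) (f f' : A.snd ⟶ A.snd) :
    baseTwist π A (f ≫ f') = baseTwist π A f ≫ baseTwist π A f' := by
  simp [baseTwist]

/-- `baseTwist id = id`. [cite: MochizukiFrdII2008, Ex 3.3 (i) p.28] -/
theorem baseTwist_id (A : C π) : baseTwist π A (𝟙 A.snd) = 𝟙 A.fst.base := by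
  simp [baseTwist]

/-- The endomorphism of `A ∈ Ob(C)` over an endomorphism `f` of `A_D ∈ Ob(D)`: `(liftEnd, f)`
(proof of Thm. 3.6 (i), p. 38). [cite: MochizukiFrdII2008, Thm 3.6 (i) p.38] -/
def liftEndC (A : C π) (f : A.snd ⟶ A.snd) : A ⟶ A where
  fst := C0.liftEnd A.fst (baseTwist π A f)
  snd := f
  w := by
    change (A.iso.hom ≫ π.map f ≫ A.iso.inv) ≫ A.iso.hom = A.iso.hom ≫ π.map f
    rw [Category.assoc, Category.assoc, Iso.inv_hom_id, Category.comp_id]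
    try rfl

/-- `liftEndC` is multiplicative. [cite: MochizukiFrdII2008, Thm 3.6 (i) p.38] -/
theorem liftEndC_comp (A : C π) (f f' : A.snd ⟶ A.snd) :
    liftEndC π A f ≫ liftEndC π A f' = liftEndC π A (f ≫ f') :=
  CFP.hom_ext (by
    change C0.liftEnd A.fst _ ≫ C0.liftEnd A.fst _ = C0.liftEnd A.fst _
    rw [C0.liftEnd_comp, ← baseTwist_comp]) rfl

/-- `liftEndC id = id`. [cite: MochizukiFrdII2008, Thm 3.6 (i) p.38] -/
theorem liftEndC_id (A : C π) : liftEndC π A (𝟙 A.snd) = 𝟙 A :=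
  CFP.hom_ext (by
    change C0.liftEnd A.fst _ = 𝟙 A.fst
    rw [baseTwist_id, C0.liftEnd_id]) rfl

/-- The automorphism of `A ∈ Ob(C)` over an automorphism of `A_D`. [cite: MochizukiFrdII2008, Thm 3.6 (i) p.38] -/
def liftAutC (A : C π) (f : A.snd ≅ A.snd) : A ≅ A where
  hom := liftEndC π A f.hom
  inv := liftEndC π A f.inv
  hom_inv_id := by rw [liftEndC_comp, f.hom_inv_id, liftEndC_id]
  inv_hom_id := by rw [liftEndC_comp, f.inv_hom_id, liftEndC_id]

/-- `liftEndC` is an isometry of `C`. [cite: MochizukiFrdII2008, Thm 3.6 (i) p.38] -/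
theorem isIsometry_liftEndC (A : C π) (f : A.snd ⟶ A.snd) :
    PreFrobenioid.IsIsometry (C.toElem π) (liftEndC π A f) := by
  change pull Φ₀ A.iso.inv (PreFrobenioid.Div C0.toElem (C0.liftEnd A.fst (baseTwist π A f))) = 1
  rw [C0.isIsometry_liftEnd]; exact map_one _

/-! ### `Aut`-ample and `End`-ample, for `C` -/

/-- `C` is of `Aut`-ample type (Thm. 3.6 (i)). [cite: MochizukiFrdII2008, Thm 3.6 (i) p.36] -/
theorem isAutAmple_C (A : C π) : PreFrobenioid.IsAutAmple (C.toElem π) A :=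
  fun f => ⟨liftAutC π A f, Iso.ext rfl⟩

/-- `C` is of `End`-ample type (Thm. 3.6 (i)). [cite: MochizukiFrdII2008, Thm 3.6 (i) p.36] -/
theorem isEndAmple_C (A : C π) : PreFrobenioid.IsEndAmple (C.toElem π) A :=
  fun f => ⟨liftEndC π A f, rfl⟩

/-! ### `Aut^sub`-ample, for `C`: lifting a sub-automorphism square of `D` -/

section SubAut

variable (A : C π) (f : A.snd ⟶ A.snd) {B' : D} (φ' : B' ⟶ A.snd) (β' : B' ≅ B')
  (hβ : β'.hom ≫ φ' = φ' ≫ f)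

/-- The arrow `Spec L = π(B') → Spec K = Base(X)` of `D₀` under `φ' : B' → A_D`.
[cite: MochizukiFrdII2008, Ex 3.3 (i) p.28] -/
def subArrow : π.obj B' ⟶ A.fst.base := π.map φ' ≫ A.iso.inv

include hβ in
/-- The sub-automorphism square maps to a commuting square of `D₀`. [cite: MochizukiFrdII2008, Thm 3.6 (i) p.38] -/
theorem subArrow_square : π.map β'.hom ≫ subArrow π A φ' = subArrow π A φ' ≫ baseTwist π A f := by
  simp only [subArrow, baseTwist, Category.assoc, Iso.inv_hom_id_assoc, ← π.map_comp_assoc, hβ]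

/-- The object `(X|_b, B')` of `C` over `B'`. [cite: MochizukiFrdII2008, Thm 3.6 (i) p.38] -/
def subObj : C π := ⟨A.fst.twistObj (subArrow π A φ'), B', Iso.refl _⟩

/-- The arrow `(X|_b, B') → (X, A_D)` of `C` over `φ'`. [cite: MochizukiFrdII2008, Thm 3.6 (i) p.38] -/
def subHom : subObj π A φ' ⟶ A where
  fst := A.fst.twistHom (subArrow π A φ')
  snd := φ'
  w := by
    change subArrow π A φ' ≫ A.iso.hom = 𝟙 _ ≫ π.map φ'
    simp [subArrow]

/-- The endomorphism of `(X|_b, B')` over `β'`. [cite: MochizukiFrdII2008, Thm 3.6 (i) p.38] -/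
def subAutHom : subObj π A φ' ⟶ subObj π A φ' where
  fst := A.fst.twistLiftEnd (subArrow π A φ') (π.map β'.hom) (baseTwist π A f) (subArrow_square π A f φ' β' hβ)
  snd := β'.hom
  w := by
    change π.map β'.hom ≫ 𝟙 _ = 𝟙 _ ≫ π.map β'.hom
    rw [Category.comp_id, Category.id_comp]

/-- The endomorphism of `(X|_b, B')` over `β'⁻¹` (same `C₀`-component: `π(β')` is an involution of `D₀`).
[cite: MochizukiFrdII2008, Thm 3.6 (i) p.38] -/
def subAutInv : subObj π A φ' ⟶ subObj π A φ' where
  fst := A.fst.twistLiftEnd (subArrow π A φ') (π.map β'.hom) (baseTwist π A f) (subArrow_square π A f φ' β' hβ)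
  snd := β'.inv
  w := by
    change π.map β'.hom ≫ 𝟙 _ = 𝟙 _ ≫ π.map β'.inv
    rw [Category.comp_id, Category.id_comp]
    exact (D0.iso_inv_eq_hom (π.mapIso β')).symm

/-- The automorphism of `(X|_b, B')` over `β'`. [cite: MochizukiFrdII2008, Thm 3.6 (i) p.38] -/
def subAut : subObj π A φ' ≅ subObj π A φ' where
  hom := subAutHom π A f φ' β' hβ
  inv := subAutInv π A f φ' β' hβ
  hom_inv_id := CFP.hom_ext (C0.twistLiftEnd_comp_self A.fst (subArrow π A φ') (π.map β'.hom)
    (baseTwist π A f) (subArrow_square π A f φ' β' hβ)) β'.hom_inv_id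
  inv_hom_id := CFP.hom_ext (C0.twistLiftEnd_comp_self A.fst (subArrow π A φ') (π.map β'.hom)
    (baseTwist π A f) (subArrow_square π A f φ' β' hβ)) β'.inv_hom_id

/-- The lifted square commutes: `β'' ≫ Φ = Φ ≫ liftEndC f`. [cite: MochizukiFrdII2008, Thm 3.6 (i) p.38] -/
theorem subAut_comm :
    (subAut π A f φ' β' hβ).hom ≫ subHom π A φ' = subHom π A φ' ≫ liftEndC π A f :=
  CFP.hom_ext (C0.twistLiftEnd_comm A.fst (subArrow π A φ') (π.map β'.hom) (baseTwist π A f)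
    (subArrow_square π A f φ' β' hβ)) hβ

/-- `subHom` is an isometry of `C`. [cite: MochizukiFrdII2008, Ex 3.3 (iii) p.28] -/
theorem isIsometry_subHom : PreFrobenioid.IsIsometry (C.toElem π) (subHom π A φ') :=
  C0.isIsometry_twistHom A.fst (subArrow π A φ')

/-- The `C₀`-component of `subAut` is an isometry. [cite: MochizukiFrdII2008, Ex 3.3 (iii) p.28] -/
theorem isIsometry_twistLiftEnd_sub :
    PreFrobenioid.IsIsometry C0.toElem (A.fst.twistLiftEnd (subArrow π A φ') (π.map β'.hom)
      (baseTwist π A f) (subArrow_square π A f φ' β' hβ)) := by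
  rw [A0.isIsometry_iff_norm_mul_tip_pow]
  change ‖((D0.Hom.act (subArrow π A φ') (A.fst.region.twistScalar (D0.Hom.twists (baseTwist π A f))) : ℂˣ) : ℂ)‖
      * (A.fst.twistObj (subArrow π A φ')).tip ^ ((1 : ℕ+) : ℕ) = (A.fst.twistObj (subArrow π A φ')).tip
  rw [D0.norm_galAct, AngularRegion.norm_twistScalar, one_mul, PNat.one_coe, pow_one]

/-- `subAut.hom` is an isometry of `C`. [cite: MochizukiFrdII2008, Ex 3.3 (iii) p.28] -/
theorem isIsometry_subAutHom : PreFrobenioid.IsIsometry (C.toElem π) (subAutHom π A f φ' β' hβ) :=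
  isIsometry_twistLiftEnd_sub π A f φ' β' hβ

/-- `subAut.inv` is an isometry of `C`. [cite: MochizukiFrdII2008, Ex 3.3 (iii) p.28] -/
theorem isIsometry_subAutInv : PreFrobenioid.IsIsometry (C.toElem π) (subAutInv π A f φ' β' hβ) :=
  isIsometry_twistLiftEnd_sub π A f φ' β' hβ

end SubAut

/-- `C` is of `Aut^sub`-ample type (Thm. 3.6 (i)): a sub-automorphism `f` of `A_D` (`β' ≫ φ' = φ' ≫ f`)
lifts to the sub-automorphism `liftEndC f` of `A`, witnessed by the lifted square over `(X|_b, B')`.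
[cite: MochizukiFrdII2008, Thm 3.6 (i) p.36] -/
theorem isAutSubAmple_C (A : C π) : PreFrobenioid.IsAutSubAmple (C.toElem π) A := by
  rintro f ⟨B', φ', β', hβ⟩
  exact ⟨liftEndC π A f, ⟨subObj π A φ', subHom π A φ', subAut π A f φ' β' hβ, subAut_comm π A f φ' β' hβ⟩,
    rfl⟩

/-! ### Metrically trivial and not group-like, for `C` -/

/-- `C` is of metrically trivial type (Thm. 3.6 (i)): for a co-angular pre-step `ψ : A → B`, factor
`ψ = β ∘ α` by Thm. 3.6 (iii) (`α` isometric, `β ∈ O^▷(B)` radial); `α` is then an isometric pre-step, so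
co-angularity (with `γ = id`) makes `α` an isomorphism. [cite: MochizukiFrdII2008, Thm 3.6 (i) p.36] -/
theorem isMetricallyTrivial_C (A : C π) : PreFrobenioid.IsMetricallyTrivial (C.toElem π) A := by
  intro B ψ hco hpre
  obtain ⟨⟨α, β⟩, ⟨hα, ⟨hβb, hβl⟩, -, hcomp⟩, -⟩ := thm36iii_factorization_C π ψ
  dsimp only at hα hβb hβl hcomp
  have hdeg : PreFrobenioid.degFr (C.toElem π) α = 1 := by
    have h := PreFrobenioid.degFr_comp (C.toElem π) α β
    rw [hcomp, show PreFrobenioid.degFr (C.toElem π) β = 1 from hβl, mul_one] at h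
    rw [← h]; exact hpre.1
  have hbase : PreFrobenioid.IsBaseIso (C.toElem π) α := by
    have h := PreFrobenioid.base_comp (C.toElem π) α β
    rw [hcomp, show PreFrobenioid.Base (C.toElem π) β = 𝟙 _ from hβb, Category.comp_id] at h
    change IsIso (PreFrobenioid.Base (C.toElem π) α)
    rw [← h]; exact hpre.2
  have hid : PreFrobenioid.IsBaseIso (C.toElem π) (𝟙 A) := by
    change IsIso (𝟙 A.snd); infer_instance
  haveI : IsIso α :=
    hco (𝟙 A) α β (by rw [Category.id_comp, hcomp]) hβl hα ⟨hdeg, hbase⟩ (Or.inr hid)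
  exact ⟨(asIso α).symm⟩

/-- `C` is NOT of group-like type (Thm. 3.6 (i)): `Φ = ℝ_{≥0}|_D ≠ 0` at any object, and `C` has objects as
soon as `D` does (here: `D` connected, the standing hypothesis of Example 3.3 (i)).
[cite: MochizukiFrdII2008, Thm 3.6 (i) p.36] -/
theorem not_isOfType_isGroupLikeObj_C (hD : IsGraphConnected D) :
    ¬ PreFrobenioid.IsOfType (PreFrobenioid.IsGroupLikeObj (C.toElem π)) := by
  obtain ⟨⟨B⟩, -⟩ := hD
  intro h
  have h1 : (Multiplicative.ofAdd (1 : ℝ≥0) : Multiplicative ℝ≥0) = 1 :=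
    h (unitObjOver π B) (Multiplicative.ofAdd (1 : ℝ≥0))
  exact one_ne_zero (congrArg Multiplicative.toAdd h1)

/-- **Theorem 3.6 (i), typology clauses, for `C = C^ℤ`** (PROVED; `D` connected): "`C^Λ` is of
`Aut`-ample, `Aut^sub`-ample, `End`-ample, and metrically trivial type, but not of group-like type" at
`Λ = ℤ`. [cite: MochizukiFrdII2008, Thm 3.6 (i) p.36] -/
theorem thm36i_ampleTypes_C (hD : IsGraphConnected D) : Thm36i_ampleTypes (C.toElem π) :=
  ⟨isAutAmple_C π, isAutSubAmple_C π, isEndAmple_C π, isMetricallyTrivial_C π,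
    not_isOfType_isGroupLikeObj_C π hD⟩

/-- The same, spelled as the `Λ = ℤ` conjunct of the instance `Thm36i_ampleTypes_C π pf rlf`
(`archFrobenioid π pf rlf ℤ = C`). [cite: MochizukiFrdII2008, Thm 3.6 (i) p.36] -/
theorem thm36i_ampleTypes_CZ (pf rlf : LambdaCompletion π) (hD : IsGraphConnected D) :
    Thm36i_ampleTypes (archFrobenioid π pf rlf MonoidType.Z).str :=
  thm36i_ampleTypes_C π hD

/-! ### The angular Frobenioid `A ⊆ C` -/

namespace A

/-- The endomorphism of `X ∈ Ob(A)` over an endomorphism of `X_D` (an isometry of `C`).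
[cite: MochizukiFrdII2008, Thm 3.6 (ii) p.37] -/
def liftEnd (X : A π) (f : X.obj.snd ⟶ X.obj.snd) : X ⟶ X :=
  ⟨liftEndC π X.obj f, isIsometry_liftEndC π X.obj f⟩

/-- The automorphism of `X ∈ Ob(A)` over an automorphism of `X_D`. [cite: MochizukiFrdII2008, Thm 3.6 (ii) p.37] -/
def liftAut (X : A π) (f : X.obj.snd ≅ X.obj.snd) : X ≅ X where
  hom := liftEnd π X f.hom
  inv := liftEnd π X f.inv
  hom_inv_id := WideSubcategory.hom_ext _ (by
    change liftEndC π X.obj f.hom ≫ liftEndC π X.obj f.inv = 𝟙 X.obj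
    rw [liftEndC_comp, f.hom_inv_id, liftEndC_id])
  inv_hom_id := WideSubcategory.hom_ext _ (by
    change liftEndC π X.obj f.inv ≫ liftEndC π X.obj f.hom = 𝟙 X.obj
    rw [liftEndC_comp, f.inv_hom_id, liftEndC_id])

/-- `A` is of `Aut`-ample type (Thm. 3.6 (ii)). [cite: MochizukiFrdII2008, Thm 3.6 (ii) p.37] -/
theorem isAutAmple (X : A π) : PreFrobenioid.IsAutAmple (A.toElem π) X :=
  fun f => ⟨liftAut π X f, Iso.ext rfl⟩

/-- `A` is of `End`-ample type (Thm. 3.6 (ii)). [cite: MochizukiFrdII2008, Thm 3.6 (ii) p.37] -/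
theorem isEndAmple (X : A π) : PreFrobenioid.IsEndAmple (A.toElem π) X :=
  fun f => ⟨liftEnd π X f, rfl⟩

/-- `A` is of `Aut^sub`-ample type (Thm. 3.6 (ii)): the lifted square of `C` consists of isometries.
[cite: MochizukiFrdII2008, Thm 3.6 (ii) p.37] -/
theorem isAutSubAmple (X : A π) : PreFrobenioid.IsAutSubAmple (A.toElem π) X := by
  rintro f ⟨B', φ', β', hβ⟩
  let B'' : A π := ⟨subObj π X.obj φ'⟩
  let Φ : B'' ⟶ X := ⟨subHom π X.obj φ', isIsometry_subHom π X.obj φ'⟩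
  let β'' : B'' ≅ B'' :=
    { hom := ⟨subAutHom π X.obj f φ' β' hβ, isIsometry_subAutHom π X.obj f φ' β' hβ⟩
      inv := ⟨subAutInv π X.obj f φ' β' hβ, isIsometry_subAutInv π X.obj f φ' β' hβ⟩
      hom_inv_id := WideSubcategory.hom_ext _ (subAut π X.obj f φ' β' hβ).hom_inv_id
      inv_hom_id := WideSubcategory.hom_ext _ (subAut π X.obj f φ' β' hβ).inv_hom_id }
  exact ⟨liftEnd π X f, ⟨B'', Φ, β'', WideSubcategory.hom_ext _ (subAut_comm π X.obj f φ' β' hβ)⟩, rfl⟩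

/-- `A` is of metrically trivial type (Thm. 3.6 (ii)): every arrow of `A` is isometric for the structure
`A → F_0`, so a co-angular pre-step `ψ` of `A` (factor it as `id ∘ ψ ∘ id`) is an isomorphism.
[cite: MochizukiFrdII2008, Thm 3.6 (ii) p.37] -/
theorem isMetricallyTrivial (X : A π) : PreFrobenioid.IsMetricallyTrivial (A.toElem π) X := by
  intro Y ψ hco hpre
  have hiso : PreFrobenioid.IsIsometry (A.toElem π) ψ := Subsingleton.elim _ _
  have hid : PreFrobenioid.IsBaseIso (A.toElem π) (𝟙 Y) := by
    change IsIso (𝟙 Y.obj.snd); infer_instance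
  haveI : IsIso ψ := hco (𝟙 X) ψ (𝟙 Y) (by rw [Category.id_comp, Category.comp_id])
    (PreFrobenioid.degFr_id _ _) hiso hpre (Or.inl hid)
  exact ⟨(asIso ψ).symm⟩

end A

/-- **Theorem 3.6 (ii), typology clauses, for the angular Frobenioid `A`** (PROVED, unconditionally,
over any base `π : D → D₀`): "`A` is of `Aut`-ample, `Aut^sub`-ample, `End`-ample, group-like, and
metrically trivial type" — the instance `Thm36ii_ampleTypes_A π`. [cite: MochizukiFrdII2008, Thm 3.6 (ii) p.37] -/
theorem thm36ii_ampleTypes_A : Thm36ii_ampleTypes_A π :=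
  ⟨A.isAutAmple π, A.isAutSubAmple π, A.isEndAmple π, A.isOfType_isGroupLikeObj π, A.isMetricallyTrivial π⟩

/-- `Thm36ii_ampleTypes_A π` — Thm. 3.6 (ii), typology clauses for the angular Frobenioid `A` over any base `π : D → D₀` — holds: the named-fact instance of `ArchimedeanTheoremsInstances.lean` is
the theorem `thm36ii_ampleTypes_A` just proved; this alias records the discharge under the tree's exact naming
convention `X_holds` (D-0026 bookkeeping, flt-inv gen 65: proof term = the existing theorem; nothing else
edited; the ledger listed the fact as unproved, `ledger fact claim` GRANTED 2026-08-28T09:4xZ). [cite: MochizukiFrdII2008, Thm 3.6 (ii) p.37] -/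
theorem Thm36ii_ampleTypes_A_holds : Thm36ii_ampleTypes_A π := thm36ii_ampleTypes_A π

end ArchFrd

end

end Literature.AlgebraicGeometry.Frobenioids
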